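import Summits.BirchSwinnertonDyer.BirchSwinnertonDyer.Theorems.SchneiderFreeAdditiveX3TateLineCharacter
import Summits.BirchSwinnertonDyer.BirchSwinnertonDyer.Theorems.SchneiderFreeAdditiveX3LocalTowerTorsionFiniteOfLine
import Summits.BirchSwinnertonDyer.Rank1Residual.AdditivePotMult.PStarTwistModel
import Summits.BirchSwinnertonDyer.Rank1Residual.Additive.RamifiedOrdinaryLineTransport
import Summits.BirchSwinnertonDyer.Rank1Residual.X2.GreenbergVatsalTateDatumRat
import HarnessLib

/-!
# The canonical line with its character on the (M) cell — hypothesis (ii) of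
# `stub_finV_potMult_of_lineCharacter` DISCHARGED modulo the published Tate uniformisation
# (crux `LocalTowerTorsionFiniteX3`, stmt-BirchSwinnertonDyer-19546)

Seat `bsd-schneider-door-c2` (cell `bsd-schneider-ideate`), gen 5; route `SchneiderFreeAdditiveX3`; sequel
of `…TateLineCharacter`.  Door-c5 gen 5 proved the registered stub `stub_finV_potMult` (Fin_v, the control
corner's last input) CONDITIONALLY on (i) the cite-only CFT fact
`ZpExtension.exists_isFrobPow_mem_kerSubgroup_of_isAnticyclotomic` and (ii) «the canonical line with its
character» (`…LocalTowerTorsionFiniteOfLine`).  This file PROVES (ii) on the (M) cell `Additive.SubM`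
(`ord_p j(E) < 0`) from the named fact A41 `Silverman1994_thmV53_corV54_tateUniformisation` (Silverman
*ATAEC* V.5.2–5.4, PUBLISHED) alone, over `(K, 𝔭)` directly:
* §1 `sq_ne_algebraMap_mul_natCast_of_valuation` — `u · p` (`u` a `𝔭`-unit) is not a square in `K_𝔭`
  when `p ∈ 𝔭 ∖ 𝔭²`;
* §2 `exists_sign_mismatch` — for the twisted Tate parametrisation `(Ψ, t)` (`t² = γ = −c₄/c₆`, a
  `𝔭`-unit) and `θ = √p* ∈ K̄` read in `K̄_𝔭`, some `σ ∈ Γ_{K_𝔭}` fixes exactly one of `t`, `θ` (`γ p*` is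
  not a square in `K_𝔭`; `K̄_𝔭/K_𝔭` is Galois, `InfiniteGalois.mem_bot_iff_fixed`);
* §3 `exists_lineCharacter_of_mult_twist_baseChange` — THE CONSTRUCTION for `C • V^{(p*)} = W`, `V/ℚ`
  globally minimal multiplicative at `p`, `𝔭 ∋ p` of degree one: `V ⊗ K` is multiplicative at `𝔭`
  (`isMinimalAt_and_hasMultiplicativeReductionAt_baseChange_of_mult`), A41 gives `(q, t, Ψ)`, X2's
  `tateDatum` is the Tate line `C_V` (`D_𝔭`-stable, divisible, `#C_V[p] = p`; character `± χ_p` and numeric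
  clauses by `…TateLineCharacter`, quotient character `σt/t` by `smul_sub_sign_smul_mem`); the
  SIGN-equivariant twisting isomorphism `e : (V ⊗ K)[p^∞] ≃ (W ⊗ K)[p^∞]` (Silverman X.5.4, sign
  `ε(σ) = σ(√p*)/√p*`; `exists_addEquiv_geomPrimaryTorsion_of_model_twist_sign`,
  `exists_localDatum_transport`) gives `C = e(C_V)`: `D_𝔭`-stable, `#C[p] ≤ p`, points of every order,
  character `ε·(σt/t)·χ_p = ± χ_p`, and the `σ` of §2 acts as `−1` modulo `C`;
* §4 **`lineCharacter_subM`** — hypothesis (ii) VERBATIM on `Additive.SubM` (`a = p + 1`, `α = 1`) from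
  A41; **`stub_finV_potMult_of_facts`** — the REGISTERED stub `stub_finV_potMult` of crux r5 (signature
  verbatim) from the CFT fact (i) and A41.

HONEST FRAMING: BSD is not advanced; Fin_v on the (M) cell is a theorem MODULO two published cite-only
inputs ((i): Tate VII §6 / Serre LCFT; A41: Silverman *ATAEC* V.5.2–5.4); the crux (both cells) stays
open until the (G-ord, `e = 2`) half of (ii) lands.  Proofs only (no definition, no named fact, no
`sorry`); helper for stmt-BirchSwinnertonDyer-19546.  References: [SilvermanATAEC1994] V.5.2–5.4;
[SilvermanAEC2009] VII.5.1 (b), X.5.4; [GreenbergVatsal2000] §2; [JetchevSkinnerWan2017] Prop. 3.3.4.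
-/

noncomputable section

open scoped Classical
namespace Summit.BirchSwinnertonDyer.BirchSwinnertonDyer.Theorems.SchneiderFreeAdditiveX3

open NumberField IsDedekindDomain Field WeierstrassCurve
  Literature.NumberTheory.EllipticCurves Literature.NumberTheory.EllipticCurves.GreenbergSelmer
  Literature.NumberTheory.GaloisRepresentations
  Summit.BirchSwinnertonDyer.Rank1Residual
  Summit.BirchSwinnertonDyer.Rank1Residual.X2.GreenbergVatsalTateDatum
  Summit.BirchSwinnertonDyer.Rank1Residual.X2.GreenbergVatsalTateDatumSign
  Summit.BirchSwinnertonDyer.Rank1Residual.X2.GreenbergVatsalTateDatumCofree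
  Summit.BirchSwinnertonDyer.Rank1Residual.X2.GreenbergVatsalReductionDatum

set_option linter.dupNamespace false

/-! ## §1. `u · p` is not a square in `K_𝔭` at a prime of degree one -/
section Valuation

variable {K : Type} [Field K] [NumberField K] {p : ℕ} [hp : Fact p.Prime]
  (𝔭 : HeightOneSpectrum (𝓞 K))

/-- In `ℤᵐ⁰`: a square `< 1` is `≤ exp (−2)` (the value group is `ℤ`). [folklore] -/
theorem sq_le_exp_neg_two_of_sq_lt_one (x : WithZero (Multiplicative ℤ)) (h : x ^ 2 < 1) :
    x ^ 2 ≤ WithZero.exp (-2 : ℤ) := by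
  rcases eq_or_ne x 0 with rfl | hx
  · simp
  · rw [← WithZero.exp_log hx, pow_two, ← WithZero.exp_add] at h ⊢
    rw [← WithZero.exp_zero, WithZero.exp_lt_exp] at h
    rw [WithZero.exp_le_exp]
    omega

omit hp in
/-- **`u · p` is not a square in `K_𝔭`** when `p ∈ 𝔭`, `p ∉ 𝔭²` and `u ∈ K` is a `𝔭`-unit: a square
root `y` would have `v(y)² = v(p)` with `exp(−2) < v(p) < 1` in the value group `ℤᵐ⁰`. [folklore] -/
theorem sq_ne_algebraMap_mul_natCast_of_valuation (h𝔭 : ((p : ℕ) : 𝓞 K) ∈ 𝔭.asIdeal)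
    (hp2 : ((p : ℕ) : 𝓞 K) ∉ 𝔭.asIdeal ^ 2) {u : K} (hu : 𝔭.valuation K u = 1)
    (y : 𝔭.adicCompletion K) : y ^ 2 ≠ algebraMap K (𝔭.adicCompletion K) (u * p) := by
  intro hy
  have hvp : 𝔭.valuation K ((p : ℕ) : K) = 𝔭.intValuation ((p : ℕ) : 𝓞 K) := by
    rw [← map_natCast (algebraMap (𝓞 K) K), HeightOneSpectrum.valuation_of_algebraMap]
  have hv' : Valued.v (algebraMap K (𝔭.adicCompletion K) (u * p)) = 𝔭.valuation K (u * p) :=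
    IsDedekindDomain.HeightOneSpectrum.valuedAdicCompletion_eq_valuation' 𝔭 _
  have hv : Valued.v y ^ 2 = 𝔭.intValuation ((p : ℕ) : 𝓞 K) := by
    rw [← map_pow, hy, hv', map_mul, hu, one_mul, hvp]
  have hlt : 𝔭.intValuation ((p : ℕ) : 𝓞 K) < 1 :=
    (HeightOneSpectrum.intValuation_lt_one_iff_mem _ _).mpr h𝔭
  have hnle : ¬ 𝔭.intValuation ((p : ℕ) : 𝓞 K) ≤ WithZero.exp (-(2 : ℕ) : ℤ) := by
    rw [HeightOneSpectrum.intValuation_le_pow_iff_mem]; exact hp2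
  rw [← hv] at hlt hnle
  exact hnle (by exact_mod_cast sq_le_exp_neg_two_of_sq_lt_one _ hlt)
/-! ## §2. An element of `Γ_{K_𝔭}` fixing exactly one of `t = √γ`, `θ = √p*` -/
/-- An element of `K̄_𝔭` whose square lies in `K_𝔭` is moved by `σ ∈ Γ_{K_𝔭}` to `±` itself. [folklore] -/
theorem toAlgEquiv_eq_or_eq_neg_of_sq_eq {z : AlgebraicClosure (𝔭.adicCompletion K)}
    {x : 𝔭.adicCompletion K}
    (hz : z ^ 2 = algebraMap (𝔭.adicCompletion K) (AlgebraicClosure (𝔭.adicCompletion K)) x)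
    (σ : absoluteGaloisGroup (𝔭.adicCompletion K)) :
    Field.absoluteGaloisGroup.toAlgEquiv (𝔭.adicCompletion K) σ z = z ∨
      Field.absoluteGaloisGroup.toAlgEquiv (𝔭.adicCompletion K) σ z = -z := by
  set s := Field.absoluteGaloisGroup.toAlgEquiv (𝔭.adicCompletion K) σ with hs
  have hsq : (s z) ^ 2 = z ^ 2 := by rw [← map_pow, hz, AlgEquiv.commutes]
  have h0 : (s z - z) * (s z + z) = 0 := by
    have : (s z - z) * (s z + z) = (s z) ^ 2 - z ^ 2 := by ring
    rw [this, hsq, sub_self]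
  rcases mul_eq_zero.mp h0 with h | h
  · exact Or.inl (sub_eq_zero.mp h)
  · exact Or.inr (eq_neg_of_add_eq_zero_left h)

omit hp in
/-- **A sign mismatch.**  `p ∈ 𝔭 ∖ 𝔭²`; `t ∈ K̄_𝔭`, `t² = γ` a `𝔭`-unit; `d = w · p`, `w` a `𝔭`-unit
(e.g. `d = p*`).  Some `σ ∈ Γ_{K_𝔭}` fixes `t` and moves `√d ∈ K̄` (read in `K̄_𝔭`), or moves `t` and
fixes `√d`: else every `σ` fixes `t · ι(√d)`, whose square `(γ w) · p` is not a square in `K_𝔭` (§1),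
while `K̄_𝔭/K_𝔭` is Galois (`InfiniteGalois.mem_bot_iff_fixed`). [folklore] -/
theorem exists_sign_mismatch (h𝔭 : ((p : ℕ) : 𝓞 K) ∈ 𝔭.asIdeal) (hp2 : ((p : ℕ) : 𝓞 K) ∉ 𝔭.asIdeal ^ 2)
    {γ w : K} (hγ : 𝔭.valuation K γ = 1) (hw : 𝔭.valuation K w = 1)
    {t : AlgebraicClosure (𝔭.adicCompletion K)}
    (ht : t ^ 2 = algebraMap (𝔭.adicCompletion K) (AlgebraicClosure (𝔭.adicCompletion K))
      (algebraMap K (𝔭.adicCompletion K) γ)) :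
    ∃ σ : absoluteGaloisGroup (𝔭.adicCompletion K),
      (Field.absoluteGaloisGroup.toAlgEquiv (𝔭.adicCompletion K) σ t = t ∧
        absGaloisRestrict K (𝔭.adicCompletion K) σ • geomSqrt (w * p) = -geomSqrt (w * p)) ∨
      (Field.absoluteGaloisGroup.toAlgEquiv (𝔭.adicCompletion K) σ t ≠ t ∧
        absGaloisRestrict K (𝔭.adicCompletion K) σ • geomSqrt (w * p) = geomSqrt (w * p)) := by
  haveI : CharZero (𝔭.adicCompletion K) := charZero_adicCompletion 𝔭
  haveI : IsGalois (𝔭.adicCompletion K) (AlgebraicClosure (𝔭.adicCompletion K)) :=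
    IsAlgClosure.isGalois _ _
  set L := 𝔭.adicCompletion K with hL
  set ι := absClosureEmbedding K L with hι
  set θ : AlgebraicClosure L := ι (geomSqrt (w * (p : K))) with hθ
  -- squares
  have hθsq : θ ^ 2 = algebraMap L (AlgebraicClosure L) (algebraMap K L (w * p)) := by
    rw [hθ, ← map_pow, geomSqrt_sq, AlgHom.commutes, ← IsScalarTower.algebraMap_apply]
  have hzsq : (t * θ) ^ 2 = algebraMap L (AlgebraicClosure L) (algebraMap K L ((γ * w) * p)) := by
    rw [mul_pow, ht, hθsq, ← map_mul, ← map_mul, mul_assoc]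
  -- `t θ` is not fixed by all of `Γ_L`
  have hnotfix : ∃ σ : absoluteGaloisGroup L,
      Field.absoluteGaloisGroup.toAlgEquiv L σ (t * θ) ≠ t * θ := by
    by_contra hall
    push Not at hall
    have hmem : t * θ ∈ (⊥ : IntermediateField L (AlgebraicClosure L)) := by
      rw [InfiniteGalois.mem_bot_iff_fixed]
      intro f
      have := hall ((Field.absoluteGaloisGroup.toAlgEquiv L).symm f)
      rwa [MulEquiv.apply_symm_apply] at this
    obtain ⟨y, hy⟩ := IntermediateField.mem_bot.mp hmem
    have hy2 : y ^ 2 = algebraMap K L ((γ * w) * p) := by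
      apply (algebraMap L (AlgebraicClosure L)).injective
      rw [map_pow, hy, hzsq]
    have hγw : 𝔭.valuation K (γ * w) = 1 := by rw [map_mul, hγ, hw, one_mul]
    exact sq_ne_algebraMap_mul_natCast_of_valuation 𝔭 h𝔭 hp2 hγw y hy2
  obtain ⟨σ, hσ⟩ := hnotfix
  refine ⟨σ, ?_⟩
  -- `σ θ = ι (res σ • √d)` and `res σ • √d = ± √d`
  have hσθ : Field.absoluteGaloisGroup.toAlgEquiv L σ θ =
      ι (absGaloisRestrict K L σ • geomSqrt (w * (p : K))) := by
    rw [hθ, ← Field.absoluteGaloisGroup.smul_def, absGaloisRestrict_apply_smul]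
  have hsqrt : absGaloisRestrict K L σ • geomSqrt (w * (p : K)) = geomSqrt (w * (p : K)) ∨
      absGaloisRestrict K L σ • geomSqrt (w * (p : K)) = -geomSqrt (w * (p : K)) := by
    rw [Field.absoluteGaloisGroup.smul_def]
    exact map_geomSqrt _ _
  rcases toAlgEquiv_eq_or_eq_neg_of_sq_eq 𝔭 ht σ with h1 | h1 <;> rcases hsqrt with h2 | h2
  · exfalso; apply hσ; rw [map_mul, h1, hσθ, h2]
  · exact Or.inl ⟨h1, h2⟩
  · refine Or.inr ⟨fun h ↦ ?_, h2⟩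
    have h2t : (2 : AlgebraicClosure L) * t = 0 := by
      have e1 : t = -t := h.symm.trans h1
      linear_combination e1
    rcases mul_eq_zero.mp h2t with h3 | h3
    · exact two_ne_zero h3
    · apply hσ
      rw [h3, zero_mul, map_zero]
  · exfalso; apply hσ; rw [map_mul, h1, hσθ, h2, map_neg, neg_mul_neg]

end Valuation
/-! ## §3. The construction at `(K, 𝔭)` for the multiplicative `p*`-twist model -/
section Construction

variable {p : ℕ} [hp : Fact p.Prime]

/-- `γ = −c₄/c₆` of the base change `V ⊗ K` of a globally minimal `V/ℚ` MULTIPLICATIVE at `p` is a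
`𝔭`-unit at every `𝔭 ∋ p` (`p ∤ c₄(V_ℤ)`, `p ∤ c₆(V_ℤ)`: Silverman VII.5.1 (b) and `1728Δ = c₄³ − c₆²`).
[cite: SilvermanAEC2009, VII.5 Prop. 5.1(b)] -/
theorem valuation_gamma_baseChange_eq_one (V : WeierstrassCurve ℚ) [V.IsElliptic] [V.IsGloballyMinimal]
    (hmult : V.HasMultiplicativeReductionAtPrime p) {K : Type} [Field K] [NumberField K]
    (𝔭 : HeightOneSpectrum (𝓞 K)) (h𝔭 : ((p : ℕ) : 𝓞 K) ∈ 𝔭.asIdeal) :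
    𝔭.valuation K (-((V.baseChange K).c₄ / (V.baseChange K).c₆)) = 1 := by
  obtain ⟨-, hc₄⟩ := Additive.dvd_and_not_dvd_c₄_of_hasMultiplicativeReductionAtPrime V p hmult
  have hc₆ := X2.GreenbergVatsalTateDatumRat.not_dvd_c₆_of_hasMultiplicativeReductionAtPrime V hmult
  have h4 : (V.baseChange K).c₄ = ((integralModelInt V).c₄ : K) := by
    rw [baseChange, map_c₄]
    conv_lhs => rw [← WeierstrassCurve.map_integralModelInt V]
    rw [WeierstrassCurve.map_c₄, eq_intCast, map_intCast]
  have h6 : (V.baseChange K).c₆ = ((integralModelInt V).c₆ : K) := by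
    rw [baseChange, map_c₆]
    conv_lhs => rw [← WeierstrassCurve.map_integralModelInt V]
    rw [WeierstrassCurve.map_c₆, eq_intCast, map_intCast]
  have hv4 : 𝔭.valuation K ((integralModelInt V).c₄ : K) = 1 := by
    rw [← map_intCast (algebraMap (𝓞 K) K), HeightOneSpectrum.valuation_of_algebraMap,
      HeightOneSpectrum.intValuation_eq_one_iff]
    exact WeierstrassCurve.intCast_notMem_asIdeal_of_not_dvd 𝔭 hp.out h𝔭 hc₄
  have hv6 : 𝔭.valuation K ((integralModelInt V).c₆ : K) = 1 := by
    rw [← map_intCast (algebraMap (𝓞 K) K), HeightOneSpectrum.valuation_of_algebraMap,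
      HeightOneSpectrum.intValuation_eq_one_iff]
    exact WeierstrassCurve.intCast_notMem_asIdeal_of_not_dvd 𝔭 hp.out h𝔭 hc₆
  rw [h4, h6, Valuation.map_neg, map_div₀, hv4, hv6, div_one]

/-- **The canonical line with its character at `(K, 𝔭)` for a ramified twist of a multiplicative
curve** — modulo the PUBLISHED Tate uniformisation A41.  `V/ℚ` globally minimal, multiplicative at
`p`; `C • V^{(p*)} = W`; `K` a number field, `𝔭 ∋ p`, `p ∉ 𝔭²`.  Then some `D_𝔭`-stable
`C ≤ (W ⊗ K)(K̄)[p^∞]` (the Tate line of `V ⊗ K` at `𝔭` along the sign-equivariant twisting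
isomorphism) has `#C[p] ≤ p`, points of every order `p^k`, an element of `D_𝔭` acting as `−1` modulo
`C`, and CHARACTER `± χ_p`: every `σ ∈ Γ_{K_𝔭}` acts on `C[p^k]` by `s · χ_p(res σ)`, `s = ±1`
(GV p. 14: `C ≅ μ_{p^∞} ⊗ (quadratic)`; Silverman X.5.4; JSW Prop. 3.3.4 Case 3(b)).
[cite: SilvermanATAEC1994, Ch. V Lemma 5.2 (c), Thm. 5.3 (a),(b), Cor. 5.4 (held copy PDF pp. 406–410)]
[cite: SilvermanAEC2009, X.5 Cor. 5.4] [cite: GreenbergVatsal2000, §2 pp. 14–15] -/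
theorem exists_lineCharacter_of_mult_twist_baseChange
    (hT : Silverman1994_thmV53_corV54_tateUniformisation.{0})
    (V : WeierstrassCurve ℚ) [V.IsElliptic] [V.IsGloballyMinimal]
    (hmult : V.HasMultiplicativeReductionAtPrime p) {W : WeierstrassCurve ℚ} [W.IsElliptic]
    {C₀ : VariableChange ℚ} (hC₀ : C₀ • V.quadraticTwist ((-1 : ℚ) ^ (p / 2) * p) = W)
    (K : Type) [Field K] [NumberField K] (𝔭 : HeightOneSpectrum (𝓞 K))
    (h𝔭 : ((p : ℕ) : 𝓞 K) ∈ 𝔭.asIdeal) (h𝔭2 : ((p : ℕ) : 𝓞 K) ∉ 𝔭.asIdeal ^ 2) :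
    ∃ (C : AddSubgroup ((W.baseChange K).geomPrimaryTorsion p)),
      (∀ d ∈ decomp 𝔭, ∀ c ∈ C, d • c ∈ C) ∧
      Set.ncard {c : (W.baseChange K).geomPrimaryTorsion p | c ∈ C ∧ p • c = 0} ≤ p ∧
      (∀ k : ℕ, ∃ c ∈ C, addOrderOf c = p ^ k) ∧
      (∃ τ ∈ decomp 𝔭, ∀ m : (W.baseChange K).geomPrimaryTorsion p, τ • m + m ∈ C) ∧
      (∀ σ : absoluteGaloisGroup (𝔭.adicCompletion K), ∃ s : ℤ, (s = 1 ∨ s = -1) ∧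
        ∀ (k : ℕ) (c : (W.baseChange K).geomPrimaryTorsion p), c ∈ C → p ^ k • c = 0 →
          ∀ N : ℤ, ((N : ℤ_[p]) - (s : ℤ_[p]) *
              ((GaloisRep.cyclotomicCharacter K p (absGaloisRestrict K (𝔭.adicCompletion K) σ) :
                ℤ_[p]ˣ) : ℤ_[p])) ∈ (Ideal.span {(p : ℤ_[p]) ^ k} : Ideal ℤ_[p]) →
            absGaloisRestrict K (𝔭.adicCompletion K) σ • c = N • c) := by
  set E := V.baseChange K with hE
  haveI : E.IsElliptic := by rw [hE, baseChange]; infer_instance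
  haveI : (W.baseChange K).IsElliptic := by rw [baseChange]; infer_instance
  -- the Tate parametrisation of `E = V ⊗ K` at `𝔭` (A41)
  have hmultK : E.HasMultiplicativeReductionAt 𝔭 :=
    (Additive.isMinimalAt_and_hasMultiplicativeReductionAt_baseChange_of_mult V hmult 𝔭 h𝔭).2
  obtain ⟨q, t, Ψ, hq0, hq1, -, ht2, hsurj, hker, hΨσ, -⟩ := hT E 𝔭 hmultK
  have hker' : ∀ u : (AlgebraicClosure (𝔭.adicCompletion K))ˣ, Ψ (Additive.ofMul u) = 0 →
      ∃ a : ℤ, (u : AlgebraicClosure (𝔭.adicCompletion K)) =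
        algebraMap (𝔭.adicCompletion K) (AlgebraicClosure (𝔭.adicCompletion K)) q ^ a :=
    fun u h ↦ (hker u).1 h
  set N := tateDatum E p Ψ (sign_disj E Ψ t hΨσ) with hN
  -- the sign-equivariant twisting isomorphism over `K`
  set d : K := ((-1 : K) ^ (p / 2)) * p with hd
  have hd0 : d ≠ 0 := by
    rw [hd]
    exact mul_ne_zero (pow_ne_zero _ (neg_ne_zero.mpr one_ne_zero))
      (Nat.cast_ne_zero.mpr hp.out.ne_zero)
  have hCW : ∃ C₁ : VariableChange K, C₁ • E.quadraticTwist d = W.baseChange K := by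
    refine ⟨C₀.map (algebraMap ℚ K), ?_⟩
    have hdmap : algebraMap ℚ K ((-1 : ℚ) ^ (p / 2) * p) = d := by
      rw [hd, map_mul, map_pow, map_neg, map_one, map_natCast]
    rw [hE, baseChange, baseChange, ← hdmap, ← map_quadraticTwist, map_variableChange, hC₀]
  obtain ⟨e, he, hepos, heneg⟩ :=
    Additive.exists_addEquiv_geomPrimaryTorsion_of_model_twist_sign p E hd0 hCW
  obtain ⟨L₂, hL₂⟩ := Additive.exists_localDatum_transport N e he
  have hsymm_pos : ∀ σ : absoluteGaloisGroup K, σ • geomSqrt d = geomSqrt d →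
      ∀ m, e.symm (σ • m) = σ • e.symm m := fun σ hσ m ↦ by
    apply e.injective; rw [e.apply_symm_apply, hepos σ hσ, e.apply_symm_apply]
  have hsymm_neg : ∀ σ : absoluteGaloisGroup K, σ • geomSqrt d = -geomSqrt d →
      ∀ m, e.symm (σ • m) = -(σ • e.symm m) := fun σ hσ m ↦ by
    apply e.injective; rw [e.apply_symm_apply, map_neg, heneg σ hσ, e.apply_symm_apply, neg_neg]
  have hdivV := tateDatum_plus_divisible E p Ψ (sign_disj E Ψ t hΨσ)
  have hdiv := Additive.transport_divisible N e L₂ hL₂ hdivV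
  have htop := Additive.transport_plus_ne_top N e L₂ hL₂
    (tateDatum_plus_ne_top E p Ψ t hΨσ hq0 hq1 hker')
  have hbot := Additive.transport_plus_ne_bot N e L₂ hL₂
    (tateDatum_plus_ne_bot E p Ψ t hΨσ hq0 hq1 hker')
  obtain ⟨hcard, hord⟩ := (W.baseChange K).lineClauses_of_divisible L₂.plus hdiv htop hbot
  refine ⟨L₂.plus, fun δ hδ c hc ↦ ?_, hcard, hord, ?_, fun σ ↦ ?_⟩
  · -- `D_𝔭`-stability
    obtain ⟨σ, rfl⟩ := (mem_decomp_iff 𝔭 δ).1 hδ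
    exact L₂.smul_mem σ hc
  · -- the element acting as `−1` modulo `C`
    have hγ := valuation_gamma_baseChange_eq_one V hmult 𝔭 h𝔭
    have hw : 𝔭.valuation K ((-1 : K) ^ (p / 2)) = 1 := by
      rw [Valuation.map_pow, Valuation.map_neg, Valuation.map_one, one_pow]
    obtain ⟨σ, hσ⟩ := exists_sign_mismatch 𝔭 h𝔭 h𝔭2 hγ hw ht2
    refine ⟨absGaloisRestrict K (𝔭.adicCompletion K) σ, ⟨σ, rfl⟩, fun m ↦ ?_⟩
    have hquot := smul_sub_sign_smul_mem E p Ψ t hΨσ hsurj hker' σ (e.symm m)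
    rw [hL₂, map_add]
    rcases hσ with ⟨hσt, hσd⟩ | ⟨hσt, hσd⟩
    · rw [if_pos hσt, one_zsmul] at hquot
      rw [hsymm_neg _ hσd, neg_add_eq_sub, ← neg_sub]
      exact neg_mem hquot
    · rw [if_neg hσt, neg_one_zsmul, sub_neg_eq_add] at hquot
      rw [hsymm_pos _ hσd]
      exact hquot
  · -- the character `± χ_p`
    obtain ⟨s, hs, hchar⟩ := tateDatum_lineCharacter E p Ψ t hΨσ hq0 hq1 hker' σ
    rcases map_geomSqrt (Field.absoluteGaloisGroup.toAlgEquiv K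
      (absGaloisRestrict K (𝔭.adicCompletion K) σ)) d with hσd | hσd <;>
      rw [← Field.absoluteGaloisGroup.smul_def] at hσd
    · -- equivariant branch: same sign
      refine ⟨s, hs, fun k c hc hpc M hM ↦ ?_⟩
      have hc' : e.symm c ∈ N.plus := (hL₂ c).1 hc
      have hpc' : p ^ k • e.symm c = 0 := by rw [← map_nsmul, hpc, map_zero]
      have h := hchar k (e.symm c) hc' hpc' M hM
      apply e.symm.injective
      rw [hsymm_pos _ hσd, h, map_zsmul]
    · -- anti-equivariant branch: opposite sign
      refine ⟨-s, by rcases hs with rfl | rfl <;> simp, fun k c hc hpc M hM ↦ ?_⟩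
      have hc' : e.symm c ∈ N.plus := (hL₂ c).1 hc
      have hpc' : p ^ k • e.symm c = 0 := by rw [← map_nsmul, hpc, map_zero]
      have hM' : (((-M : ℤ) : ℤ_[p]) - (s : ℤ_[p]) *
          ((GaloisRep.cyclotomicCharacter K p (absGaloisRestrict K (𝔭.adicCompletion K) σ) :
            ℤ_[p]ˣ) : ℤ_[p])) ∈ (Ideal.span {(p : ℤ_[p]) ^ k} : Ideal ℤ_[p]) := by
        have := Submodule.neg_mem _ hM
        convert this using 1
        push_cast
        ring
      have h := hchar k (e.symm c) hc' hpc' (-M) hM'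
      apply e.symm.injective
      rw [hsymm_neg _ hσd, h, map_zsmul, neg_zsmul, neg_neg]

end Construction
/-! ## §4. Hypothesis (ii) on the (M) cell and the registered stub from facts -/
section Cell

/-- **Hypothesis (ii) «the canonical line with its character» of `stub_finV_potMult_of_lineCharacter`
on the (M) cell, VERBATIM, from the published Tate uniformisation A41**: for `(E, p) ∈ X3 ∩ (M)`, `p`
odd, `K` imaginary quadratic with `p` split, `𝔭 ∣ p`, the Tate line of the multiplicative `p*`-twist
model (`AdditivePotMult.PotMult.exists_mult_pStar_twist_model`) at `(K, 𝔭)` is the required `C`, with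
`a = p + 1`, `α = 1` (character `± ε`).  Analytic rank and reducibility are not used.
[cite: SilvermanATAEC1994, Ch. V Lemma 5.2 (c), Thm. 5.3 (a),(b), Cor. 5.4 (held copy PDF pp. 406–410)]
[cite: JetchevSkinnerWan2017, §3.3 Prop. 3.3.4 Case 3(b) (arXiv:1512.06894 p. 13)] -/
theorem lineCharacter_subM (hT : Silverman1994_thmV53_corV54_tateUniformisation.{0}) :
    ∀ (W : WeierstrassCurve ℚ) [W.IsElliptic] [W.IsGloballyMinimal] (p : ℕ) [Fact p.Prime],
      W.analyticRank = 1 → p ≠ 2 → Literature.NumberTheory.EllipticCurves.Rank1Residual.ClassX3 W p →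
        Summit.BirchSwinnertonDyer.Rank1Residual.Additive.SubM W p →
        ∀ (K : Type) [Field K] [NumberField K], IsImaginaryQuadratic K → X11b.SplitsIn K p →
          ∀ (𝔭 : HeightOneSpectrum (𝓞 K)), ((p : ℕ) : 𝓞 K) ∈ 𝔭.asIdeal →
          ∃ (C : AddSubgroup ((W.baseChange K).geomPrimaryTorsion p)) (a : ℤ) (α : ℤ_[p]ˣ),
            (∀ d ∈ decomp 𝔭, ∀ c ∈ C, d • c ∈ C) ∧
            Set.ncard {c : (W.baseChange K).geomPrimaryTorsion p | c ∈ C ∧ p • c = 0} ≤ p ∧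
            (∀ k : ℕ, ∃ c ∈ C, addOrderOf c = p ^ k) ∧
            (∃ τ ∈ decomp 𝔭, ∀ m : (W.baseChange K).geomPrimaryTorsion p, τ • m + m ∈ C) ∧
            ((α : ℤ_[p])) ^ 2 = a * (α : ℤ_[p]) - p ∧
            (∀ (σ : absoluteGaloisGroup (𝔭.adicCompletion K)) (n : ℕ), IsFrobPow σ (n : ℤ) →
              ∃ s : ℤ, (s = 1 ∨ s = -1) ∧
                ∀ (k : ℕ) (c : (W.baseChange K).geomPrimaryTorsion p), c ∈ C → p ^ k • c = 0 →
                  ∀ N : ℤ, ((N : ℤ_[p]) - s *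
                      ((GaloisRep.cyclotomicCharacter K p
                          (absGaloisRestrict K (𝔭.adicCompletion K) σ) * (α⁻¹) ^ n : ℤ_[p]ˣ) :
                        ℤ_[p]) ∈ (Ideal.span {(p : ℤ_[p]) ^ k} : Ideal ℤ_[p])) →
                    absGaloisRestrict K (𝔭.adicCompletion K) σ • c = N • c) := by
  intro W _ _ p _ _ hp2 hX hM K _ _ hK hsplit 𝔭 h𝔭
  have hPM : AdditivePotMult.PotMult W p := ⟨hX.2, hM⟩
  obtain ⟨V, _, _, C₀, hV, hC₀⟩ := hPM.exists_mult_pStar_twist_model hp2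
  haveI := liesOver_span_of_natCast_mem (K := K) h𝔭
  have hdeg := ramificationIdx_mul_inertiaDeg_eq_one_of_splitsIn hK.1 hsplit h𝔭
  have h𝔭2 := Summit.Ventures.HodgeRepro2.T5DegreeOneNumberField.natCast_notMem_sq 𝔭 p hdeg
  obtain ⟨C, hCD, hcard, hord, hτ, hchar⟩ :=
    exists_lineCharacter_of_mult_twist_baseChange hT V hV hC₀ K 𝔭 h𝔭 h𝔭2
  refine ⟨C, (p : ℤ) + 1, 1, hCD, hcard, hord, hτ, by push_cast; ring, fun σ n _ ↦ ?_⟩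
  obtain ⟨s, hs, hc⟩ := hchar σ
  refine ⟨s, hs, fun k c hcC hpc N hN ↦ hc k c hcC hpc N ?_⟩
  simpa only [inv_one, one_pow, mul_one] using hN

/-- **Registered stub `stub_finV_potMult` of crux `LocalTowerTorsionFiniteX3`
(stmt-BirchSwinnertonDyer-19546) FROM FACTS** — signature verbatim, from the published cite-only inputs
(i) `ZpExtension.exists_isFrobPow_mem_kerSubgroup_of_isAnticyclotomic` (Tate VII §6, Serre LCFT) and A41
`Silverman1994_thmV53_corV54_tateUniformisation` (Silverman *ATAEC* V.5.2–5.4): door-c5's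
`stub_finV_potMult_of_lineCharacter` with (ii) discharged by `lineCharacter_subM`.  Fin_v on the (M)
cell (`E(K̄)[p^∞]^{D_𝔭 ⊓ ker κ}` finite); BSD is not advanced: CONDITIONAL on (i) and A41.
[cite: JetchevSkinnerWan2017, §3.3 Prop. 3.3.4 Case 3(b), Remark 3.3.5 (arXiv:1512.06894 p. 13)]
[cite: SilvermanATAEC1994, Ch. V Lemma 5.2 (c), Thm. 5.3 (a),(b), Cor. 5.4 (held copy PDF pp. 406–410)] -/
theorem stub_finV_potMult_of_facts
    (hCFT : ∀ (K : Type) [Field K] [NumberField K] (p : ℕ) [Fact p.Prime],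
      ZpExtension.exists_isFrobPow_mem_kerSubgroup_of_isAnticyclotomic K p)
    (hT : Silverman1994_thmV53_corV54_tateUniformisation.{0}) :
    ∀ (W : WeierstrassCurve ℚ) [W.IsElliptic] [W.IsGloballyMinimal] (p : ℕ) [Fact p.Prime],
      W.analyticRank = 1 → p ≠ 2 → Literature.NumberTheory.EllipticCurves.Rank1Residual.ClassX3 W p →
        Summit.BirchSwinnertonDyer.Rank1Residual.Additive.SubM W p →
        (∀ (K : Type) [Field K] [NumberField K],
          Literature.NumberTheory.EllipticCurves.IsImaginaryQuadratic K →
          Summit.BirchSwinnertonDyer.Rank1Residual.X11b.SplitsIn K p →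
          ∀ (κ : Literature.NumberTheory.EllipticCurves.ZpExtension K p), κ.IsAnticyclotomic →
          ∀ (𝔭 : IsDedekindDomain.HeightOneSpectrum (NumberField.RingOfIntegers K)),
            ((p : ℕ) : NumberField.RingOfIntegers K) ∈ 𝔭.asIdeal →
            (FixedPoints.addSubgroup ↥(Literature.NumberTheory.EllipticCurves.GreenbergSelmer.decomp 𝔭 ⊓
              κ.kerSubgroup) ((W.baseChange K).geomPrimaryTorsion p) :
            Set ((W.baseChange K).geomPrimaryTorsion p)).Finite) :=
  stub_finV_potMult_of_lineCharacter hCFT (lineCharacter_subM hT)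

end Cell

end Summit.BirchSwinnertonDyer.BirchSwinnertonDyer.Theorems.SchneiderFreeAdditiveX3

end
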